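import Literature.Probability.Percolation.ArmEventsInterface
import HarnessLib

/-!
# The U-turn of an inextendable two-arm crossing

Topic: Probability / Percolation. First lattice step towards the equicontinuity of the two-arm
probabilities in the radii (the source of the no-touching hypothesis (b) of the two-arm scaling
limit, `TwoArmScalingLimitFromLoops.lean` / `TwoArmNoTouchingReduction.lean`; F. Camia,
C. M. Newman, Comm. Math. Phys. 268 (2006), §6: a crossing that cannot be pushed to a nearby level
forces three half-plane arms at its extremal level). For a configuration `ω` with finitely many
open sites:

* `IsSiteInterfaceLoop.exists_min_level` — an interface loop has a minimal level: an integer `m`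
  bounding below the graph norms of all vertices of all its faces and attained at some face;
* **`exists_isSiteInterfaceLoop_uturn`** — if `ω ∈ armEvent (open, closed) n₁ N` but
  `ω ∉ armEvent (open, closed) n₂ N` (`1 ≤ n₂ ≤ n₁ ≤ N`), some interface loop of `ω`, based at a
  face with a vertex of norm `m`, has all the vertices of all its faces of norm `≥ m`, where
  `n₂ ≤ m ≤ n₁ - 1`, and visits a face with a vertex of norm `N + 1`: the interface crossing the
  annulus `[n₁, N]` (`exists_isSiteInterfaceLoop_of_mem_armEvent_two`, `ArmEventsInterface.lean`)
  descends to the level `m` and not below — a loop visiting the level `n₂ - 1` and the level `N + 1`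
  would give the forbidden crossing (`IsSiteInterfaceLoop.mem_armEvent_two`);
* `IsSiteInterfaceLoop.exists_two_branches` — the two arcs of an interface loop from its base face
  to another of its faces, as walks with the interface dart condition (forward) and the reversed
  dart condition (backward), meeting only at their endpoints.

Everything is proved; no definitions and no named facts are introduced.

## References

* F. Camia, C. M. Newman, Comm. Math. Phys. 268 (2006), §6 [CamiaNewman2006].
* S. Smirnov, W. Werner, Math. Res. Lett. 8 (2001), §4 [SmirnovWernerMRL2001].
-/

noncomputable section

open Set Metric Complex Filter MeasureTheory
open Literature.Topology.PlaneTopology Literature.Probability.RandomPlanarGeometry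
open scoped unitInterval Topology

namespace Literature.Probability.Percolation

open LatticeModels

/-! ### The minimal level of an interface loop -/

/-- **An interface loop has a minimal level**: there is an integer `m` such that every vertex of
every face of the loop has graph norm `≥ m`, with equality for some vertex of some face.
[folklore] -/
theorem IsSiteInterfaceLoop.exists_min_level {ω : SiteConfig (Site 2)} {f₀ : HexVertex} {w : hexGraph.Walk f₀ f₀}
    (hw : IsSiteInterfaceLoop ω w) :
    ∃ m : ℤ, (∀ G ∈ w.support, ∀ v ∈ hexFaceVertices G, m ≤ triNorm v) ∧
      ∃ G ∈ w.support, ∃ v ∈ hexFaceVertices G, triNorm v = m := by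
  classical
  have _ := hw
  set S : Finset (Site 2) := w.support.toFinset.biUnion hexFaceVertices with hS
  have hSne : S.Nonempty := by
    refine ⟨faceVertex f₀ 0, Finset.mem_biUnion.2 ⟨f₀, ?_, faceVertex_mem f₀ 0⟩⟩
    rw [List.mem_toFinset]; exact w.start_mem_support
  set T : Finset ℤ := S.image triNorm with hT
  have hTne : T.Nonempty := hSne.image _
  refine ⟨T.min' hTne, fun G hG v hv ↦ Finset.min'_le _ _ (Finset.mem_image_of_mem _
    (Finset.mem_biUnion.2 ⟨G, List.mem_toFinset.2 hG, hv⟩)), ?_⟩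
  obtain ⟨v, hvS, hvm⟩ := Finset.mem_image.1 (Finset.min'_mem T hTne)
  obtain ⟨G, hG, hvG⟩ := Finset.mem_biUnion.1 hvS
  exact ⟨G, List.mem_toFinset.1 hG, v, hvG, hvm⟩

/-! ### The U-turn of an inextendable crossing -/

/-- **The U-turn lemma.** Let `ω` have finitely many open sites, `1 ≤ n₂ ≤ n₁ ≤ N`, and suppose
that the annulus `Λ_N ∖ Λ̊_{n₁}` is crossed by two arms of opposite colours but `Λ_N ∖ Λ̊_{n₂}` is
not. Then some interface loop of `ω` is based at a face with a vertex of norm `m`, has all the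
vertices of all its faces of norm `≥ m`, and visits a face with a vertex of norm `N + 1`, where
`n₂ ≤ m ≤ n₁ - 1`: the interface crossing `[n₁, N]` descends exactly to the level `m` (a loop
through the levels `n₂ - 1` and `N + 1` would be a crossing of `[n₂, N]`). This is the
configuration from which three half-plane arms at the level `m` are read off (Camia–Newman 2006,
§6). [cite: CamiaNewman2006, §6] -/
theorem exists_isSiteInterfaceLoop_uturn {ω : SiteConfig (Site 2)} (hfin : ω.Finite) {n₂ n₁ N : ℕ}
    (hn₂ : 1 ≤ n₂) (h₂₁ : n₂ ≤ n₁) (h₁N : n₁ ≤ N) (h₁ : ω ∈ armEvent ![true, false] n₁ N)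
    (h₂ : ω ∉ armEvent ![true, false] n₂ N) :
    ∃ (F : HexVertex) (w : hexGraph.Walk F F) (m : ℕ), IsSiteInterfaceLoop ω w ∧ n₂ ≤ m ∧ m + 1 ≤ n₁ ∧
      (∀ G ∈ w.support, ∀ v ∈ hexFaceVertices G, (m : ℤ) ≤ triNorm v) ∧
      (∃ v ∈ hexFaceVertices F, triNorm v = m) ∧
      ∃ G₁ ∈ w.support, ∃ v ∈ hexFaceVertices G₁, triNorm v = N + 1 := by
  classical
  obtain ⟨F₀, w₀, hw₀, ⟨v₀, hv₀, hv₀n⟩, G₁, hG₁, v₁, hv₁, hv₁N⟩ :=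
    exists_isSiteInterfaceLoop_of_mem_armEvent_two hfin (le_trans hn₂ h₂₁) h₁N h₁
  obtain ⟨m, hmle, G, hG, v, hv, hvm⟩ := hw₀.exists_min_level
  -- `m ≤ n₁ - 1`
  have hm₁ : m + 1 ≤ n₁ := by
    have := hmle F₀ w₀.start_mem_support v₀ hv₀; omega
  -- `n₂ ≤ m`: otherwise the loop crosses `[n₂, N]`
  have hm₂ : (n₂ : ℤ) ≤ m := by
    by_contra hlt
    push Not at hlt
    have harm := hw₀.mem_armEvent_two (r := n₂ - 1) (R := N + 1) (by omega) hG hG₁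
      ⟨v, hv, by push_cast [hn₂]; omega⟩ ⟨v₁, hv₁, by push_cast; omega⟩
    rw [show n₂ - 1 + 1 = n₂ by omega, show N + 1 - 1 = N by omega] at harm
    exact h₂ harm
  have hm0 : 0 ≤ m := le_trans (by positivity) hm₂
  -- rotate to the face attaining the minimum
  refine ⟨G, w₀.rotate G hG, m.toNat, hw₀.rotate' hG, by omega, by omega, fun G' hG' u hu ↦ ?_,
    ⟨v, hv, by omega⟩, G₁, ?_, v₁, hv₁, hv₁N⟩
  · rw [SimpleGraph.Walk.mem_support_rotate_iff] at hG'
    have := hmle G' hG' u hu; omega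
  · rw [SimpleGraph.Walk.mem_support_rotate_iff]; exact hG₁

/-! ### The two branches of an interface loop -/

/-- **The two arcs of an interface loop** from its base face `F` to another face `G₁` of the loop:
a walk `p : F → G₁` every dart of which has an open site on its left and a closed site on its
right (an initial segment of the loop), and a walk `q : F → G₁` every dart of which has an open
site on its RIGHT and a closed site on its left (the final segment of the loop, reversed), which
meet only at `F` and `G₁`. [folklore] -/
theorem IsSiteInterfaceLoop.exists_two_branches {ω : SiteConfig (Site 2)} {F : HexVertex} {w : hexGraph.Walk F F}
    (hw : IsSiteInterfaceLoop ω w) {G₁ : HexVertex} (hG₁ : G₁ ∈ w.support) (hne : G₁ ≠ F) :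
    ∃ (p q : hexGraph.Walk F G₁),
      (∀ i < p.length, ∃ e : triGraph.Dart, triEdgeFaces e = (p.getVert (i + 1), p.getVert i) ∧ e.fst ∈ ω ∧ e.snd ∉ ω) ∧
      (∀ i < q.length, ∃ e : triGraph.Dart, triEdgeFaces e = (q.getVert i, q.getVert (i + 1)) ∧ e.fst ∈ ω ∧ e.snd ∉ ω) ∧
      (∀ x ∈ p.support, x ∈ q.support → x = F ∨ x = G₁) ∧
      (∀ x ∈ p.support, x ∈ w.support) ∧ (∀ x ∈ q.support, x ∈ w.support) := by
  classical
  obtain ⟨i₁, hi₁, hi₁le⟩ := SimpleGraph.Walk.mem_support_iff_exists_getVert.1 hG₁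
  have hi₁pos : 0 < i₁ := by
    rcases Nat.eq_zero_or_pos i₁ with h | h
    · rw [h, SimpleGraph.Walk.getVert_zero] at hi₁; exact absurd hi₁.symm hne
    · exact h
  have hi₁lt : i₁ < w.length := by
    rcases hi₁le.lt_or_eq with h | h
    · exact h
    · rw [h, SimpleGraph.Walk.getVert_length] at hi₁; exact absurd hi₁.symm hne
  set p : hexGraph.Walk F G₁ := (w.take i₁).copy rfl hi₁ with hp
  set q : hexGraph.Walk F G₁ := ((w.drop i₁).copy hi₁ rfl).reverse with hq
  have hplen : p.length = i₁ := by
    rw [hp, SimpleGraph.Walk.length_copy, SimpleGraph.Walk.take_length]; exact min_eq_left hi₁le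
  have hqlen : q.length = w.length - i₁ := by
    rw [hq, SimpleGraph.Walk.length_reverse, SimpleGraph.Walk.length_copy, SimpleGraph.Walk.drop_length]
  have hpget : ∀ k ≤ i₁, p.getVert k = w.getVert k := by
    intro k hk
    rw [hp, SimpleGraph.Walk.getVert_copy, SimpleGraph.Walk.take_getVert, min_eq_right hk]
  have hqget : ∀ k ≤ w.length - i₁, q.getVert k = w.getVert (w.length - k) := by
    intro k hk
    rw [hq, SimpleGraph.Walk.getVert_reverse, SimpleGraph.Walk.getVert_copy, SimpleGraph.Walk.drop_getVert,
      SimpleGraph.Walk.length_copy, SimpleGraph.Walk.drop_length]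
    congr 1; omega
  refine ⟨p, q, fun i hi ↦ ?_, fun i hi ↦ ?_, fun x hxp hxq ↦ ?_, fun x hx ↦ ?_, fun x hx ↦ ?_⟩
  · rw [hplen] at hi
    obtain ⟨h', hf, hl, hr⟩ := hw.dart_spec (i := i) (by omega)
    refine ⟨⟨(hw.lv i, hw.rv i), h'⟩, ?_, hl, hr⟩
    rw [hpget i hi.le, hpget (i + 1) hi]; exact hf
  · rw [hqlen] at hi
    set j := w.length - (i + 1) with hj
    obtain ⟨h', hf, hl, hr⟩ := hw.dart_spec (i := j) (by omega)
    refine ⟨⟨(hw.lv j, hw.rv j), h'⟩, ?_, hl, hr⟩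
    rw [hqget i hi.le, hqget (i + 1) hi, hf, show j + 1 = w.length - i by omega]
  · obtain ⟨a, ha, hale⟩ := SimpleGraph.Walk.mem_support_iff_exists_getVert.1 hxp
    obtain ⟨b, hb, hble⟩ := SimpleGraph.Walk.mem_support_iff_exists_getVert.1 hxq
    rw [hplen] at hale
    rw [hqlen] at hble
    rw [hpget a hale] at ha
    rw [hqget b hble] at hb
    -- `w.getVert a = w.getVert (w.length - b)` with `a ≤ i₁ ≤ w.length - b`
    rcases Nat.eq_or_lt_of_le hble with hb0 | hb0
    · -- `b = w.length - i₁`: then `w.length - b = i₁`, so `x = G₁`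
      right; rw [← hb, hb0, show w.length - (w.length - i₁) = i₁ by omega, hi₁]
    rcases Nat.eq_zero_or_pos b with hbz | hbz
    · -- `b = 0`: `x = w.getVert w.length = F`
      left; rw [← hb, hbz, Nat.sub_zero, SimpleGraph.Walk.getVert_length]
    · -- otherwise injectivity of `getVert` on `[0, length)` forces `a = w.length - b`, impossible
      have hinj := hw.isCycle.getVert_injOn' (by simp only [Set.mem_setOf_eq]; omega : a ∈ {i | i ≤ w.length - 1})
        (by simp only [Set.mem_setOf_eq]; omega : w.length - b ∈ {i | i ≤ w.length - 1}) (ha.trans hb.symm)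
      omega
  · obtain ⟨a, ha, hale⟩ := SimpleGraph.Walk.mem_support_iff_exists_getVert.1 hx
    rw [hplen] at hale
    rw [← ha, hpget a hale]; exact w.getVert_mem_support a
  · obtain ⟨b, hb, hble⟩ := SimpleGraph.Walk.mem_support_iff_exists_getVert.1 hx
    rw [hqlen] at hble
    rw [← hb, hqget b hble]; exact w.getVert_mem_support _

end Literature.Probability.Percolation
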